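import Literature.NumberTheory.Automorphic.UnitaryGroupHyperbolicSwap
import HarnessLib

/-!
# The two root images of a hyperbolic pair in `𝕎_v` at a non-split place: anisotropy modulo the kernel, duality,
# dimension `2`

Topic `NumberTheory/Automorphic`; namespace `Literature.NumberTheory.Automorphic.UnitaryGroup` (sequel of
`UnitaryGroupIsotropicRootSymplectic` / `UnitaryGroupHyperbolicSwap`: `localRootNil … r = 𝔫_r`, `alt_polar_localRootNil_self`,
`alt_polar_localRootNil_localRootNil_partner`, `range_localRootNil_eq_of_partner`).  KERNEL ONLY: theorems; no definition,
no named fact, no `sorry`.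

Setting of those files at a finite place `v` of the quadratic extension `E/F` (`K = F_v`, `E_v = UnitaryGroup.LocalRing E v`,
`σ = c ⊗ 1`, Gram `J_v` of `UnitaryGroup.«local» E c N J v`, `𝕎_v = F_vᴺ × F_vᴺ` with `A = alt (polar β_T)`,
`reIm = QuadraticCoordinates.reIm` of `quadraticLocalEquiv`), now with `E_v` a FIELD (`IsField`, i.e. `v` non-split), for an
isotropic `r` with a partner `r'` (`h(r, r') = 1`):

* general-argument forms of the pairing identities: `A(x, 𝔫 y) = A(y, 𝔫 x)`, `A(𝔫 x, y) = −A(x, 𝔫 y)`, `A(𝔫_r x, 𝔫_r y) = 0`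
  (`alt_polar_localRootNil_comm'`, `alt_polar_localRootNil_left`, `alt_polar_localRootNil_localRootNil'`);
* **anisotropy modulo the kernel**: `𝔫_r (reIm u) = 0 ↔ h(r, u) = 0 ↔ A(reIm u, 𝔫_r (reIm u)) = 0` (the norm form of the
  field `E_v` is anisotropic), hence `A(x, 𝔫_r x) = 0 → 𝔫_r x = 0` (`localRootNil_eq_zero_of_alt_polar_self_eq_zero`)
  [MoeglinVignerasWaldspurger1987, Chap. 1 I.11 (4 b)];
* **duality of `im 𝔫_r` and `im 𝔫_{r'}`**: an element of `im 𝔫_r` pairing to `0` with all of `im 𝔫_{r'}` is `0`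
  (`eq_zero_of_mem_range_localRootNil_of_forall`), i.e. `Disjoint (range 𝔫_r) (BilinForm.orthogonal A (range 𝔫_{r'}))`
  (`disjoint_range_localRootNil_orthogonal`);
* **`dim_{F_v} im 𝔫_r = 2`** (`finrank_range_localRootNil`: `im 𝔫_r = reIm(E_v r) ≅ E_v`, `[E_v : F_v] = 2`).

These are, block by block, the hypotheses `hd₁ hd₂ hdim` of the polarisation mover of the cell's line
`b4-rank-one-theta-lines-disjoint` (row IV-4(c1), pieces P3/P4).  Nothing about theta lifts is asserted here.

## References
* [MoeglinVignerasWaldspurger1987] C. Mœglin, M.-F. Vignéras, J.-L. Waldspurger, LNM 1291 (1987), Chap. 1 I.11, I.17.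
* [Dieudonne1971GroupesClassiques] J. Dieudonné, *La géométrie des groupes classiques*, 3e éd. (1971), Chap. II §5.
-/

set_option autoImplicit false

noncomputable section

open Matrix NumberField IsDedekindDomain
open Literature.RepresentationTheory.HeisenbergGroup
open Literature.NumberTheory.GelbartRogawski1991.UnitaryDualPair.LocalSplitting (iota localPairing)

namespace Literature.NumberTheory.Automorphic.UnitaryGroup

section Duality

variable {F : Type} [Field F] [NumberField F] (E : Type) [Field E] [NumberField E] [Algebra F E]
  [Algebra.IsQuadraticExtension F E] (c : E ≃ₐ[F] E) (N : ℕ) (J : Matrix (Fin N) (Fin N) E)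
  (v : HeightOneSpectrum (𝓞 F)) {δ : E} (hcδ : c δ = -δ) (hδ : δ ≠ 0) {d : F} (hd : δ * δ = algebraMap F E d)

/-! ### General-argument forms of the pairing identities -/

/-- `A(x, 𝔫 y) = A(y, 𝔫 x)` for all `x, y ∈ 𝕎_v`. [cite: MoeglinVignerasWaldspurger1987, Ch. 1 I.17] -/
theorem alt_polar_localRootNil_comm' (T : Matrix (Fin N) (Fin N) F) (hT : T.IsSymm)
    (hJ : J = T.map (algebraMap F E)) (hJh : (J.map c)ᵀ = J) (r : Fin N → LocalRing E v)
    (p q : (Fin N → v.adicCompletion F) × (Fin N → v.adicCompletion F)) :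
    alt (polar (localPairing F N T v)) p (localRootNil E c N J v hcδ hδ hd r q) =
      alt (polar (localPairing F N T v)) q (localRootNil E c N J v hcδ hδ hd r p) := by
  obtain ⟨u, rfl⟩ := (QuadraticCoordinates.reIm (quadraticLocalEquiv E v c hcδ hδ).toLinearEquiv.toAddEquiv (Fin N)).surjective p
  obtain ⟨u', rfl⟩ := (QuadraticCoordinates.reIm (quadraticLocalEquiv E v c hcδ hδ).toLinearEquiv.toAddEquiv (Fin N)).surjective q
  exact alt_polar_localRootNil_comm E c N J v hcδ hδ hd T hT hJ hJh r u u'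

/-- **skewness**: `A(𝔫 x, y) = −A(x, 𝔫 y)`. [cite: MoeglinVignerasWaldspurger1987, Ch. 1 I.17] -/
theorem alt_polar_localRootNil_left (T : Matrix (Fin N) (Fin N) F) (hT : T.IsSymm)
    (hJ : J = T.map (algebraMap F E)) (hJh : (J.map c)ᵀ = J) (r : Fin N → LocalRing E v)
    (p q : (Fin N → v.adicCompletion F) × (Fin N → v.adicCompletion F)) :
    alt (polar (localPairing F N T v)) (localRootNil E c N J v hcδ hδ hd r p) q =
      -alt (polar (localPairing F N T v)) p (localRootNil E c N J v hcδ hδ hd r q) := by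
  rw [alt_polar_localRootNil_comm' E c N J v hcδ hδ hd T hT hJ hJh r p q, alt_apply, alt_apply, neg_sub]

/-- `A(𝔫_r x, 𝔫_r y) = 0` for all `x, y ∈ 𝕎_v` (`r` isotropic). [cite: MoeglinVignerasWaldspurger1987, Ch. 1 I.17] -/
theorem alt_polar_localRootNil_localRootNil' (T : Matrix (Fin N) (Fin N) F) (hT : T.IsSymm)
    (hJ : J = T.map (algebraMap F E)) {r : Fin N → LocalRing E v}
    (hr : hermForm (conjLocal E c v) ((adelicForm E N J).map (adeleToLocal E v)) r r = 0)
    (p q : (Fin N → v.adicCompletion F) × (Fin N → v.adicCompletion F)) :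
    alt (polar (localPairing F N T v)) (localRootNil E c N J v hcδ hδ hd r p) (localRootNil E c N J v hcδ hδ hd r q) = 0 := by
  obtain ⟨u, rfl⟩ := (QuadraticCoordinates.reIm (quadraticLocalEquiv E v c hcδ hδ).toLinearEquiv.toAddEquiv (Fin N)).surjective p
  obtain ⟨u', rfl⟩ := (QuadraticCoordinates.reIm (quadraticLocalEquiv E v c hcδ hδ).toLinearEquiv.toAddEquiv (Fin N)).surjective q
  exact alt_polar_localRootNil_localRootNil E c N J v hcδ hδ hd T hT hJ hr u u'

/-! ### `E_v` a field: anisotropy modulo the kernel -/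

omit [Algebra.IsQuadraticExtension F E] in
/-- in the field `E_v`: `σ(α) α = 0 → α = 0`. [cite: MoeglinVignerasWaldspurger1987, Chap. 1 I.11 (4 b)] -/
theorem eq_zero_of_conjLocal_mul_self_eq_zero (hE : IsField (LocalRing E v)) {α : LocalRing E v}
    (h : conjLocal E c v α * α = 0) : α = 0 := by
  letI : Field (LocalRing E v) := hE.toField
  rcases mul_eq_zero.1 h with h1 | h1
  · exact (map_eq_zero_iff (conjLocal E c v) (conjLocal E c v).injective).1 h1
  · exact h1

include hd in
/-- **`𝔫_r (reIm u) = 0 ↔ h(r, u) = 0`** (`E_v` a field, `r ≠ 0`). [cite: MoeglinVignerasWaldspurger1987, Ch. 1 I.17] -/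
theorem localRootNil_reIm_eq_zero_iff (hE : IsField (LocalRing E v)) {r : Fin N → LocalRing E v} (hr0 : r ≠ 0)
    (u : Fin N → LocalRing E v) :
    localRootNil E c N J v hcδ hδ hd r
        (QuadraticCoordinates.reIm (quadraticLocalEquiv E v c hcδ hδ).toLinearEquiv.toAddEquiv (Fin N) u) = 0 ↔
      hermForm (conjLocal E c v) ((adelicForm E N J).map (adeleToLocal E v)) r u = 0 := by
  letI : Field (LocalRing E v) := hE.toField
  rw [localRootNil_reIm, map_eq_zero_iff _ (QuadraticCoordinates.reIm _ (Fin N)).injective]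
  constructor
  · intro h
    obtain ⟨i, hi⟩ := Function.ne_iff.1 hr0
    have h' := congrFun h i
    rw [Pi.smul_apply, smul_eq_mul, Pi.zero_apply] at h'
    rcases mul_eq_zero.1 h' with h'' | h''
    · rcases mul_eq_zero.1 h'' with h3 | h3
      · exact absurd h3 ((map_ne_zero_iff (algebraMap E (LocalRing E v)) (algebraMap E (LocalRing E v)).injective).2 hδ)
      · exact h3
    · exact absurd h'' hi
  · intro h
    rw [h, mul_zero, zero_smul]

/-- **`A(reIm u, 𝔫_r (reIm u)) = 0 ↔ h(r, u) = 0`** (`E_v` a field: the norm form is anisotropic).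
[cite: MoeglinVignerasWaldspurger1987, Chap. 1 I.11 (4 b)] -/
theorem alt_polar_localRootNil_self_eq_zero_iff (T : Matrix (Fin N) (Fin N) F) (hT : T.IsSymm)
    (hJ : J = T.map (algebraMap F E)) (hE : IsField (LocalRing E v)) (hJh : (J.map c)ᵀ = J)
    (r u : Fin N → LocalRing E v) :
    alt (polar (localPairing F N T v))
        (QuadraticCoordinates.reIm (quadraticLocalEquiv E v c hcδ hδ).toLinearEquiv.toAddEquiv (Fin N) u)
        (localRootNil E c N J v hcδ hδ hd r
          (QuadraticCoordinates.reIm (quadraticLocalEquiv E v c hcδ hδ).toLinearEquiv.toAddEquiv (Fin N) u)) = 0 ↔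
      hermForm (conjLocal E c v) ((adelicForm E N J).map (adeleToLocal E v)) r u = 0 := by
  constructor
  · intro h
    have h' := toLocalRing_alt_polar_localRootNil_self E c N J v hcδ hδ hd T hT hJ hJh r u
    rw [h, map_zero] at h'
    exact eq_zero_of_conjLocal_mul_self_eq_zero E c v hE h'.symm
  · intro h
    rw [alt_polar_localRootNil_self E c N J v hcδ hδ hd T hT hJ hJh, h, map_zero, map_zero]
    ring

/-- **anisotropy modulo the kernel**: `A(x, 𝔫_r x) = 0 → 𝔫_r x = 0` (`E_v` a field). [cite: MoeglinVignerasWaldspurger1987, Chap. 1 I.11 (4 b)] -/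
theorem localRootNil_eq_zero_of_alt_polar_self_eq_zero (T : Matrix (Fin N) (Fin N) F) (hT : T.IsSymm)
    (hJ : J = T.map (algebraMap F E)) (hE : IsField (LocalRing E v)) (hJh : (J.map c)ᵀ = J)
    (r : Fin N → LocalRing E v) {p : (Fin N → v.adicCompletion F) × (Fin N → v.adicCompletion F)}
    (h : alt (polar (localPairing F N T v)) p (localRootNil E c N J v hcδ hδ hd r p) = 0) :
    localRootNil E c N J v hcδ hδ hd r p = 0 := by
  obtain ⟨u, rfl⟩ := (QuadraticCoordinates.reIm (quadraticLocalEquiv E v c hcδ hδ).toLinearEquiv.toAddEquiv (Fin N)).surjective p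
  rw [alt_polar_localRootNil_self_eq_zero_iff E c N J v hcδ hδ hd T hT hJ hE hJh] at h
  rw [localRootNil_reIm, h, mul_zero, zero_smul, map_zero]

/-! ### `E_v` a field: duality of the two root images -/

include hd in
/-- **duality, pointwise**: an `x ∈ im 𝔫_r` with `A(x, 𝔫_{r'} y) = 0` for all `y` is `0` (`h(r, r') = 1`, `E_v` a field:
`A(𝔫_r(reIm u), 𝔫_{r'}(reIm(t • r))) = −d · im(σ(α) t)` for all `t`, and `t = δ σ(α)⁻¹` gives `−d ≠ 0`).
[cite: MoeglinVignerasWaldspurger1987, Ch. 1 I.17] -/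
theorem eq_zero_of_mem_range_localRootNil_of_forall (T : Matrix (Fin N) (Fin N) F) (hT : T.IsSymm)
    (hJ : J = T.map (algebraMap F E)) (hE : IsField (LocalRing E v)) {r r' : Fin N → LocalRing E v}
    (hrr' : hermForm (conjLocal E c v) ((adelicForm E N J).map (adeleToLocal E v)) r r' = 1)
    (hr'r : hermForm (conjLocal E c v) ((adelicForm E N J).map (adeleToLocal E v)) r' r = 1)
    {p : (Fin N → v.adicCompletion F) × (Fin N → v.adicCompletion F)}
    (hp : p ∈ LinearMap.range (localRootNil E c N J v hcδ hδ hd r))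
    (h : ∀ q, alt (polar (localPairing F N T v)) p (localRootNil E c N J v hcδ hδ hd r' q) = 0) : p = 0 := by
  letI : Field (LocalRing E v) := hE.toField
  have hq := isQuadraticCoordinates_local E v c hcδ hδ hd
  obtain ⟨p₀, rfl⟩ := hp
  obtain ⟨u, rfl⟩ := (QuadraticCoordinates.reIm (quadraticLocalEquiv E v c hcδ hδ).toLinearEquiv.toAddEquiv (Fin N)).surjective p₀
  set α := hermForm (conjLocal E c v) ((adelicForm E N J).map (adeleToLocal E v)) r u with hα
  by_cases hα0 : α = 0
  · rw [localRootNil_reIm, ← hα, hα0, mul_zero, zero_smul, map_zero]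
  · exfalso
    have hσα : conjLocal E c v α ≠ 0 := (map_ne_zero_iff _ (conjLocal E c v).injective).2 hα0
    have hd0 : (d : v.adicCompletion F) ≠ 0 := by
      intro hd0
      have : algebraMap E (LocalRing E v) δ * algebraMap E (LocalRing E v) δ = 0 := by rw [hq.mul_self, hd0, map_zero]
      exact (mul_ne_zero ((map_ne_zero_iff _ (algebraMap E (LocalRing E v)).injective).2 hδ)
        ((map_ne_zero_iff _ (algebraMap E (LocalRing E v)).injective).2 hδ)) this
    -- pair against `𝔫_{r'} (reIm (t • r))` with `t = δ σ(α)⁻¹`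
    obtain ⟨b, hb⟩ := hE.mul_inv_cancel hσα
    have key := h (QuadraticCoordinates.reIm (quadraticLocalEquiv E v c hcδ hδ).toLinearEquiv.toAddEquiv (Fin N)
      ((algebraMap E (LocalRing E v) δ * b) • r))
    rw [alt_polar_localRootNil_localRootNil_partner E c N J v hcδ hδ hd T hT hJ hrr', hermForm_smul_right, hr'r, mul_one,
      ← hα, show conjLocal E c v α * (algebraMap E (LocalRing E v) δ * b) = algebraMap E (LocalRing E v) δ by
        rw [mul_left_comm, hb, mul_one], hq.im_delta, mul_one, neg_eq_zero] at key
    exact hd0 key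

include hd in
/-- **duality, as submodules**: `Disjoint (im 𝔫_r) (A-orthogonal of im 𝔫_{r'})` (the hypothesis shape of the tree's
polarisation mover). [cite: MoeglinVignerasWaldspurger1987, Ch. 1 I.17] -/
theorem disjoint_range_localRootNil_orthogonal (T : Matrix (Fin N) (Fin N) F) (hT : T.IsSymm)
    (hJ : J = T.map (algebraMap F E)) (hE : IsField (LocalRing E v)) {r r' : Fin N → LocalRing E v}
    (hrr' : hermForm (conjLocal E c v) ((adelicForm E N J).map (adeleToLocal E v)) r r' = 1)
    (hr'r : hermForm (conjLocal E c v) ((adelicForm E N J).map (adeleToLocal E v)) r' r = 1) :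
    Disjoint (LinearMap.range (localRootNil E c N J v hcδ hδ hd r))
      (LinearMap.BilinForm.orthogonal (alt (polar (localPairing F N T v)))
        (LinearMap.range (localRootNil E c N J v hcδ hδ hd r'))) := by
  rw [Submodule.disjoint_def]
  intro p hp hp'
  refine eq_zero_of_mem_range_localRootNil_of_forall E c N J v hcδ hδ hd T hT hJ hE hrr' hr'r hp fun q => ?_
  have h := (LinearMap.BilinForm.mem_orthogonal_iff.1 hp') _ (LinearMap.mem_range_self _ q)
  -- `h : A (𝔫_{r'} q) p = 0`; antisymmetry of `A`
  rw [alt_apply, sub_eq_zero] at h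
  rw [alt_apply, h, sub_self]

/-! ### `E_v` a field: the dimension of a root image -/

include hd in
/-- `reIm (k • w) = k • reIm w` for `k ∈ F_v` (the `F_v`-module structure of `E_vᴺ`). [cite: CasselsFrohlichANT1967, Ch. II §10] -/
theorem reIm_smul (k : v.adicCompletion F) (w : Fin N → LocalRing E v) :
    QuadraticCoordinates.reIm (quadraticLocalEquiv E v c hcδ hδ).toLinearEquiv.toAddEquiv (Fin N) (k • w) =
      k • QuadraticCoordinates.reIm (quadraticLocalEquiv E v c hcδ hδ).toLinearEquiv.toAddEquiv (Fin N) w := by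
  have hk : k • w = toLocalRing E v k • w := funext fun i => smul_localRing_def E v k (w i)
  rw [hk, reIm_toLocalRing_smul E c N v hcδ hδ hd]

include hd in
/-- **`dim_{F_v} im 𝔫_r = 2`** at a non-split place (`E_v` a field, `r` with a partner `r'`): `t ↦ 𝔫_r (reIm (t • r'))` is an
`F_v`-linear bijection `E_v ≃ im 𝔫_r` and `[E_v : F_v] = 2`. [cite: MoeglinVignerasWaldspurger1987, Ch. 1 I.17] -/
theorem finrank_range_localRootNil (hE : IsField (LocalRing E v)) {r r' : Fin N → LocalRing E v}
    (hrr' : hermForm (conjLocal E c v) ((adelicForm E N J).map (adeleToLocal E v)) r r' = 1) :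
    Module.finrank (v.adicCompletion F) (LinearMap.range (localRootNil E c N J v hcδ hδ hd r)) = 2 := by
  letI : Field (LocalRing E v) := hE.toField
  have hr0 : r ≠ 0 := by
    rintro rfl
    rw [hermForm_zero_left] at hrr'
    exact zero_ne_one hrr'
  -- the `F_v`-linear parametrisation `t ↦ reIm (t • r')`
  let g : LocalRing E v →ₗ[v.adicCompletion F] ((Fin N → v.adicCompletion F) × (Fin N → v.adicCompletion F)) :=
    { toFun := fun t => QuadraticCoordinates.reIm (quadraticLocalEquiv E v c hcδ hδ).toLinearEquiv.toAddEquiv (Fin N) (t • r')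
      map_add' := fun t t' => by rw [add_smul, map_add]
      map_smul' := fun k t => by rw [RingHom.id_apply, smul_assoc, reIm_smul E c N v hcδ hδ hd] }
  set f := localRootNil E c N J v hcδ hδ hd r ∘ₗ g with hf
  have hfapply : ∀ t, f t = QuadraticCoordinates.reIm (quadraticLocalEquiv E v c hcδ hδ).toLinearEquiv.toAddEquiv (Fin N)
      ((algebraMap E (LocalRing E v) δ * t) • r) := fun t =>
    localRootNil_reIm_smul_partner E c N J v hcδ hδ hd hrr' t
  have hrange : LinearMap.range (localRootNil E c N J v hcδ hδ hd r) = LinearMap.range f := by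
    apply le_antisymm
    · rintro _ ⟨p, rfl⟩
      obtain ⟨u, rfl⟩ := (QuadraticCoordinates.reIm (quadraticLocalEquiv E v c hcδ hδ).toLinearEquiv.toAddEquiv (Fin N)).surjective p
      refine ⟨hermForm (conjLocal E c v) ((adelicForm E N J).map (adeleToLocal E v)) r u, ?_⟩
      rw [hfapply, localRootNil_reIm]
    · rw [hf]
      exact LinearMap.range_comp_le_range _ _
  have hinj : Function.Injective f := by
    intro t t' htt'
    rw [hfapply, hfapply] at htt'
    have h1 := (QuadraticCoordinates.reIm _ (Fin N)).injective htt'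
    obtain ⟨i, hi⟩ := Function.ne_iff.1 hr0
    have h2 := congrFun h1 i
    simp only [Pi.smul_apply, smul_eq_mul] at h2
    have hδ' : algebraMap E (LocalRing E v) δ ≠ 0 :=
      (map_ne_zero_iff _ (algebraMap E (LocalRing E v)).injective).2 hδ
    exact mul_left_cancel₀ hδ' (mul_right_cancel₀ hi h2)
  rw [hrange, LinearMap.finrank_range_of_inj hinj, finrank_localRing E v]

end Duality

end Literature.NumberTheory.Automorphic.UnitaryGroup

end
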